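import Summits.FinalStateConjecture.FinalStateConjecture.Theorems.LaminatedThresholdAssemblyFrame

/-!
# Crux `LaminatedThreshold` · line `heteroclinic_comb` — its Stub 1 (`stub_combLemma`) is FALSE as typed

Negative support lemma for crux item stmt-FinalStateConjecture-16893 (route LaminatedThreshold). The line
`Cruxes/LaminatedThreshold/Lines/heteroclinic_comb.lean` (crux-strategist, 2026-08-17) reduces the crux to
three stubs, the first of which is an ABSTRACT COMB LEMMA of hyperbolic dynamics on a Banach space `E × ℝ`
(Mathlib vocabulary only): for a `C¹` map `T` with `T 0 = 0`, `DT(0) = (x, t) ↦ (S x, μ t)`,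
`‖S‖ < 1 < μ`, there should be `r₁ > 0` such that ANY two `C¹` seed hypersurfaces `{G₁ = 0} ∋ (0, σ₁)`,
`{G₂ = 0} ∋ (0, σ₂)` with `0 < σ₁ < r₁`, `-r₁ < σ₂ < 0`, transverse to the vertical (`∂ₜGᵢ ≠ 0`), generate
for every `ε > 0` a comb chart `(ρ, Φ, K)` near `0`: `Φ` continuous on `ball 0 ρ`, `Φ 0 = 0 ∈ K`, `K`
accumulating at `0` from both sides, and `Φ p ∈ K ⇒` the forward orbit of `p` stays in `ball 0 ε` for
ever, or hits a seed inside `ball (0, σᵢ) ε`.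

`stub_combLemma_false` (this file): **the statement is false**, by an explicit planar counterexample.
The seeds are anchored at the points `(0, σᵢ)` of the `t`-AXIS, but nothing ties the unstable manifold of
`T` to that axis. Take `E = ℝ`, `T (x, t) = (x/2 + (7/2) t², 2t)` (so `S = ½`, `μ = 2`, `T` polynomial,
`DT(0) = diag(½, 2)`): its unstable manifold is the parabola `x = t²`, and the closed orbit formula
`T^[n] (x, t) = ((2ⁿt)² + (x − t²)/2ⁿ, 2ⁿt)` (`iterate_combT`) shows that an orbit from the box `|x|, |t| < ρ₀`
which is at height EXACTLY `±σ` (forced by `Gᵢ (T^[n] p) = 0` for the flat seeds `Gᵢ (x, t) = t ∓ σ`) has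
horizontal coordinate `≥ σ² − ρ₀ − ρ₀² ≥ σ²/2 =: ε`, i.e. it misses the `ε`-ball around `(0, ±σ)`; and no
point with `t ≠ 0` has a bounded orbit. So inside a small ball the saturated set is contained in the
stable line `{t = 0}`, while `Φ`, being continuous with `Φ 0 = 0 ∈ K` and `K` accumulating at `0` from both
sides, takes a value in `K` somewhere on the punctured vertical segment `{(0, s) : 0 < s < ρ'}` — the
real-line lamination lemma `real_lamination` of `LaminatedThresholdAssemblyFrame` — a contradiction. This
works for EVERY `r₁ > 0` (seeds at `σ = r₁/2`), so no admissible radius exists.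

Consequence for the line (a `stub-false` in the crux protocol): the comb lemma must be re-typed with the
seeds placed on (or transversality measured against) the UNSTABLE MANIFOLD of `T` — e.g. under the extra
normalisation that the `t`-axis is `T`-invariant (adapted coordinates straightening `W^u`), which the
vacuum carrier stub would then have to supply. The composition `LaminatedThreshold_of` of the line is
untouched; only Stub 1's hypothesis list is insufficient. Pure Mathlib analysis; no named facts.
-/

-- every `Summit.FinalStateConjecture.FinalStateConjecture.…` name repeats the summit = sub-problem segment (D-0017 layout)
set_option linter.dupNamespace false

noncomputable section

open Set Filter Metric Function
open scoped Topology

namespace Summit.FinalStateConjecture.FinalStateConjecture.Theorems.LaminatedThreshold.Negative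

/-! Throughout, the counterexample map is `T (x, t) = (x/2 + (7/2) t², 2 t)` on `ℝ × ℝ` (written as an
explicit lambda, so that this negative file declares no definition): contracting by `½` in `x`, expanding
by `2` in `t` at the origin, with unstable manifold the parabola `x = t²`. -/

/-- `T 0 = 0`. [folklore] -/
theorem combT_zero : (fun p : ℝ × ℝ ↦ (p.1 / 2 + 7 / 2 * p.2 ^ 2, 2 * p.2)) 0 = 0 := by
  simp

/-- **Closed orbit formula**: `T^[n] (x, t) = ((2ⁿ t)² + (x − t²)/2ⁿ, 2ⁿ t)` (the deviation `x − t²`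
from the invariant parabola is halved at each step). [folklore] -/
theorem iterate_combT (n : ℕ) (x t : ℝ) :
    (fun p : ℝ × ℝ ↦ (p.1 / 2 + 7 / 2 * p.2 ^ 2, 2 * p.2))^[n] (x, t) =
      ((2 ^ n * t) ^ 2 + (x - t ^ 2) / 2 ^ n, 2 ^ n * t) := by
  induction n with
  | zero => simp
  | succ n ih =>
    rw [Function.iterate_succ_apply', ih]
    ext
    · simp only
      rw [pow_succ, pow_succ]
      field_simp
      ring
    · simp only
      rw [pow_succ]
      ring

/-- `T` is smooth (polynomial), in particular `C¹` on every ball. [folklore] -/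
theorem contDiff_combT : ContDiff ℝ 1 (fun p : ℝ × ℝ ↦ (p.1 / 2 + 7 / 2 * p.2 ^ 2, 2 * p.2)) := by
  fun_prop

/-- The derivative of `T` at `0` is `(x, t) ↦ (x/2, 2t)`, i.e. `(S ∘ fst, μ • snd)` with `S = ½ • id`,
`μ = 2`. [folklore] -/
theorem hasFDerivAt_combT :
    HasFDerivAt (fun p : ℝ × ℝ ↦ (p.1 / 2 + 7 / 2 * p.2 ^ 2, 2 * p.2)) ((((1 / 2 : ℝ) • ContinuousLinearMap.id ℝ ℝ).comp
      (ContinuousLinearMap.fst ℝ ℝ ℝ)).prod ((2 : ℝ) • ContinuousLinearMap.snd ℝ ℝ ℝ)) 0 := by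
  rw [hasFDerivAt_iff_isLittleO_nhds_zero]
  have hrem : ∀ h : ℝ × ℝ, (fun p : ℝ × ℝ ↦ (p.1 / 2 + 7 / 2 * p.2 ^ 2, 2 * p.2)) (0 + h) - (fun p : ℝ × ℝ ↦ (p.1 / 2 + 7 / 2 * p.2 ^ 2, 2 * p.2)) 0 -
      ((((1 / 2 : ℝ) • ContinuousLinearMap.id ℝ ℝ).comp (ContinuousLinearMap.fst ℝ ℝ ℝ)).prod
        ((2 : ℝ) • ContinuousLinearMap.snd ℝ ℝ ℝ)) h = (7 / 2 * h.2 ^ 2, 0) := by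
    intro h
    ext
    · simp
      ring
    · simp
  simp_rw [hrem]
  refine Asymptotics.isLittleO_iff.2 fun c hc ↦ ?_
  rw [Metric.eventually_nhds_iff]
  refine ⟨2 * c / 7, by positivity, fun h hh ↦ ?_⟩
  rw [dist_zero_right] at hh
  have h2 : |h.2| ≤ ‖h‖ := by rw [← Real.norm_eq_abs]; exact norm_snd_le h
  have hn : ‖((7 / 2 * h.2 ^ 2 : ℝ), (0 : ℝ))‖ = 7 / 2 * h.2 ^ 2 := by
    rw [Prod.norm_def, Real.norm_eq_abs, norm_zero, abs_of_nonneg (by positivity)]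
    exact max_eq_left (by positivity)
  rw [hn]
  have hsq : h.2 ^ 2 ≤ ‖h‖ * ‖h‖ := by
    rw [pow_two, ← abs_mul_abs_self]
    exact mul_le_mul h2 h2 (abs_nonneg _) (norm_nonneg _)
  calc 7 / 2 * h.2 ^ 2 ≤ 7 / 2 * (‖h‖ * ‖h‖) := by gcongr
    _ = (7 / 2 * ‖h‖) * ‖h‖ := by ring
    _ ≤ c * ‖h‖ := by
        apply mul_le_mul_of_nonneg_right _ (norm_nonneg _)
        linarith [hh.le]

/-- `‖½ • id‖ < 1`. [folklore] -/
theorem norm_half_id_lt_one : ‖(1 / 2 : ℝ) • ContinuousLinearMap.id ℝ ℝ‖ < 1 := by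
  rw [norm_smul]
  have h1 : ‖ContinuousLinearMap.id ℝ ℝ‖ ≤ 1 := ContinuousLinearMap.norm_id_le
  have h2 : ‖(1 / 2 : ℝ)‖ = 1 / 2 := by norm_num
  rw [h2]
  linarith

/-- **No seed is ever hit from a small box.** If `|x| < ρ₀`, `|t| < ρ₀`, `ρ₀ ≤ 1`, `ρ₀ ≤ σ²/4`, and the
`n`-th iterate of `(x, t)` is at height exactly `2ⁿ t` with `(2ⁿ t)² = σ²`, then its horizontal
coordinate is `≥ σ²/2`; in particular it is not `σ²/2`-close to the `t`-axis. [folklore] -/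
theorem fst_iterate_ge {x t ρ₀ σ : ℝ} (hx : |x| < ρ₀) (ht : |t| < ρ₀) (h1 : ρ₀ ≤ 1)
    (hσ : ρ₀ ≤ σ ^ 2 / 4) {n : ℕ} (hn : (2 ^ n * t) ^ 2 = σ ^ 2) :
    σ ^ 2 / 2 ≤ ((fun p : ℝ × ℝ ↦ (p.1 / 2 + 7 / 2 * p.2 ^ 2, 2 * p.2))^[n] (x, t)).1 := by
  rw [iterate_combT]
  simp only
  rw [hn]
  have h2n : (1 : ℝ) ≤ 2 ^ n := one_le_pow₀ (by norm_num)
  have hpos : (0 : ℝ) < 2 ^ n := by positivity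
  have htsq : t ^ 2 ≤ |t| := by
    rw [← sq_abs]
    have : |t| ≤ 1 := by linarith
    nlinarith [abs_nonneg t]
  have hxle : -ρ₀ < x := (abs_lt.1 hx).1
  -- `(x - t²)/2ⁿ ≥ -(|x| + t²) ≥ -2ρ₀ ≥ -σ²/2`
  have hnum : -(2 * ρ₀) ≤ x - t ^ 2 := by linarith
  have hdiv : -(2 * ρ₀) ≤ (x - t ^ 2) / 2 ^ n := by
    rcases le_or_gt 0 (x - t ^ 2) with hge | hlt
    · have : 0 ≤ (x - t ^ 2) / 2 ^ n := div_nonneg hge hpos.le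
      linarith [this, (abs_nonneg x).trans hx.le]
    · have : (x - t ^ 2) ≤ (x - t ^ 2) / 2 ^ n := by
        rw [le_div_iff₀ hpos]
        nlinarith
      linarith
  linarith

/-- **`stub_combLemma` of line `heteroclinic_comb` is false** (the registered signature, verbatim, negated).
Witness: `E = ℝ`, `T (x, t) = (x/2 + (7/2) t², 2t)`, `S = ½ • id`, `μ = 2`, `r₀ = 1`; against any `r₁ > 0` the flat seeds
`Gᵢ (x, t) = t ∓ r₁/2` at `σ₁ = r₁/2`, `σ₂ = -r₁/2` and `ε = σ²/2`: inside the box of size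
`ρ₀ = min 1 (σ²/4)` the saturated set lies in `{t = 0}` (`fst_iterate_ge`; unbounded heights `2ⁿ t`),
whereas `real_lamination` puts a point of `Φ ⁻¹' K` on the punctured vertical segment through `0`.
[folklore] -/
theorem stub_combLemma_false : ¬ (∀ (E : Type) [NormedAddCommGroup E] [NormedSpace ℝ E] [CompleteSpace E] (T : E × ℝ → E × ℝ) (S : E →L[ℝ] E) (μ r₀ : ℝ), T 0 = 0 → 0 < r₀ → ContDiffOn ℝ 1 T (Metric.ball 0 r₀) → HasFDerivAt T ((S.comp (ContinuousLinearMap.fst ℝ E ℝ)).prod (μ • ContinuousLinearMap.snd ℝ E ℝ)) 0 → ‖S‖ < 1 → 1 < μ → ∃ r₁ : ℝ, 0 < r₁ ∧ ∀ (σ₁ σ₂ : ℝ) (G₁ G₂ : E × ℝ → ℝ), 0 < σ₁ ∧ σ₁ < r₁ ∧ -r₁ < σ₂ ∧ σ₂ < 0 ∧ (∃ r' : ℝ, 0 < r' ∧ ContDiffOn ℝ 1 G₁ (Metric.ball ((0 : E), σ₁) r') ∧ ContDiffOn ℝ 1 G₂ (Metric.ball ((0 : E), σ₂) r')) ∧ G₁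 ((0 : E), σ₁) = 0 ∧ fderiv ℝ G₁ ((0 : E), σ₁) ((0 : E), (1 : ℝ)) ≠ 0 ∧ G₂ ((0 : E), σ₂) = 0 ∧ fderiv ℝ G₂ ((0 : E), σ₂) ((0 : E), (1 : ℝ)) ≠ 0 → ∀ ε : ℝ, 0 < ε → ∃ ρ : ℝ, 0 < ρ ∧ ∃ (Φ : E × ℝ → ℝ) (K : Set ℝ), Φ 0 = 0 ∧ (0 : ℝ) ∈ K ∧ (∀ η : ℝ, 0 < η → (K ∩ Set.Ioo (0 - η) 0).Nonempty ∧ (K ∩ Set.Ioo 0 (0 + η)).Nonempty) ∧ ContinuousOn Φ (Metric.ball 0 ρ) ∧ ∀ p ∈ Metric.ball (0 : E × ℝ) ρ, Φ p ∈ K → ((∀ n : ℕ, T^[n] (p) ∈ Metric.ball (0 : E × ℝ) ε) ∨ (∃ n : ℕ, T^[n] (p) ∈ Metric.ball ((0 : E), σ₁) ε ∧ G₁ (T^[n] (p)) = 0) ∨ (∃ n : ℕ, T^[n] (p) ∈ Metric.ball ((0 : E), σ₂) ε ∧ G₂ (T^[n] (p)) = 0))) := by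
  intro h
  obtain ⟨r₁, hr₁, hcomb⟩ := h ℝ (fun p : ℝ × ℝ ↦ (p.1 / 2 + 7 / 2 * p.2 ^ 2, 2 * p.2))
    ((1 / 2 : ℝ) • ContinuousLinearMap.id ℝ ℝ) 2 1 combT_zero
    one_pos contDiff_combT.contDiffOn hasFDerivAt_combT norm_half_id_lt_one one_lt_two
  -- the flat seeds at heights `±σ`, `σ = r₁/2`
  set σ : ℝ := r₁ / 2 with hσ
  have hσpos : 0 < σ := by positivity
  have hseed := hcomb σ (-σ) (fun p ↦ p.2 - σ) (fun p ↦ p.2 + σ)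
    ⟨hσpos, by rw [hσ]; linarith, by rw [hσ]; linarith, by linarith,
      ⟨1, one_pos, by fun_prop, by fun_prop⟩, by simp, ?_, by simp, ?_⟩ (σ ^ 2 / 2) (by positivity)
  rotate_left
  · rw [show (fun p : ℝ × ℝ ↦ p.2 - σ) = fun p ↦ (ContinuousLinearMap.snd ℝ ℝ ℝ) p - σ from rfl,
      fderiv_sub_const, ContinuousLinearMap.fderiv]
    simp
  · rw [show (fun p : ℝ × ℝ ↦ p.2 + σ) = fun p ↦ (ContinuousLinearMap.snd ℝ ℝ ℝ) p + σ from rfl,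
      fderiv_add_const, ContinuousLinearMap.fderiv]
    simp
  obtain ⟨ρ, hρ, Φ, K, hΦ0, hK0, hacc, hcont, hsat⟩ := hseed
  -- the small box
  set ρ₀ : ℝ := min 1 (σ ^ 2 / 4) with hρ₀
  have hρ₀pos : 0 < ρ₀ := by positivity
  have hρ₀1 : ρ₀ ≤ 1 := min_le_left _ _
  have hρ₀σ : ρ₀ ≤ σ ^ 2 / 4 := min_le_right _ _
  set ρ' : ℝ := min ρ ρ₀ with hρ'
  have hρ'pos : 0 < ρ' := lt_min hρ hρ₀pos
  have hρ'ρ : ρ' ≤ ρ := min_le_left _ _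
  have hρ'ρ₀ : ρ' ≤ ρ₀ := min_le_right _ _
  -- STEP 1: inside the box, a saturated point lies on the stable line `t = 0`
  have hsat0 : ∀ x t : ℝ, |x| < ρ' → |t| < ρ' → ((x, t) : ℝ × ℝ) ∈ Metric.ball (0 : ℝ × ℝ) ρ →
      Φ (x, t) ∈ K → t = 0 := by
    intro x t hx ht hball hK
    by_contra htne
    have hx₀ : |x| < ρ₀ := hx.trans_le hρ'ρ₀
    have ht₀ : |t| < ρ₀ := ht.trans_le hρ'ρ₀
    rcases hsat (x, t) hball hK with h0 | ⟨n, hn, hG⟩ | ⟨n, hn, hG⟩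
    · -- bounded orbit is impossible: heights `2ⁿ t` are unbounded
      have htpos : 0 < |t| := abs_pos.2 htne
      obtain ⟨n, hn⟩ := pow_unbounded_of_one_lt (σ ^ 2 / 2 / |t|) (one_lt_two (α := ℝ))
      have hge : σ ^ 2 / 2 < |2 ^ n * t| := by
        rw [abs_mul, abs_of_pos (by positivity : (0 : ℝ) < 2 ^ n)]
        rwa [div_lt_iff₀ htpos] at hn
      have hmem := h0 n
      rw [Metric.mem_ball, dist_zero_right, iterate_combT] at hmem
      have hsnd := norm_snd_le (((2 ^ n * t) ^ 2 + (x - t ^ 2) / 2 ^ n, 2 ^ n * t) : ℝ × ℝ)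
      simp only [Real.norm_eq_abs] at hsnd
      linarith
    · -- seed 1 is hit exactly: `2ⁿ t = σ`, then the point is far from the axis
      rw [iterate_combT] at hG
      simp only at hG
      have htn : 2 ^ n * t = σ := by linarith
      have hsq : (2 ^ n * t) ^ 2 = σ ^ 2 := by rw [htn]
      have hfst := fst_iterate_ge hx₀ ht₀ hρ₀1 hρ₀σ hsq
      rw [Metric.mem_ball, Prod.dist_eq, max_lt_iff] at hn
      have h1 := hn.1
      rw [Real.dist_eq, sub_zero] at h1
      linarith [(abs_lt.1 h1).2]
    · -- seed 2 is hit exactly: `2ⁿ t = -σ`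
      rw [iterate_combT] at hG
      simp only at hG
      have htn : 2 ^ n * t = -σ := by linarith
      have hsq : (2 ^ n * t) ^ 2 = σ ^ 2 := by rw [htn]; ring
      have hfst := fst_iterate_ge hx₀ ht₀ hρ₀1 hρ₀σ hsq
      rw [Metric.mem_ball, Prod.dist_eq, max_lt_iff] at hn
      have h1 := hn.1
      rw [Real.dist_eq, sub_zero] at h1
      linarith [(abs_lt.1 h1).2]
  -- STEP 2: along the vertical segment through `0`, `Φ` takes a value in `K` at a positive height
  set f : ℝ → ℝ := fun s ↦ Φ ((0 : ℝ), s) with hf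
  have hf0 : f 0 = 0 := by
    have h00 : ((0 : ℝ), (0 : ℝ)) = (0 : ℝ × ℝ) := rfl
    simp only [hf]
    rw [h00]
    exact hΦ0
  have hseg : ∀ s ∈ Set.Ico (0 : ℝ) ρ', ((0 : ℝ), s) ∈ Metric.ball (0 : ℝ × ℝ) ρ := by
    intro s hs
    rw [Metric.mem_ball, dist_zero_right, Prod.norm_def, norm_zero, Real.norm_eq_abs,
      abs_of_nonneg hs.1, max_eq_right hs.1]
    exact hs.2.trans_le hρ'ρ
  have hfcont : ContinuousOn f (Set.Ico 0 ρ') := by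
    have hγ : Continuous fun s : ℝ ↦ ((0 : ℝ), s) := continuous_const.prodMk continuous_id
    exact hcont.comp hγ.continuousOn fun s hs ↦ hseg s hs
  have hacc' : ∀ η : ℝ, 0 < η →
      (K ∩ Set.Ioo (f 0 - η) (f 0)).Nonempty ∧ (K ∩ Set.Ioo (f 0) (f 0 + η)).Nonempty := by
    rw [hf0]; exact hacc
  have hK0' : f 0 ∈ K := by rw [hf0]; exact hK0
  obtain ⟨s, hs, hsK⟩ := real_lamination hρ'pos hK0' hacc' hfcont
  -- contradiction: `(0, s)` is saturated with `s ≠ 0`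
  have hs0 : s = 0 := hsat0 0 s (by rw [abs_zero]; exact hρ'pos)
    (by rw [abs_of_pos hs.1]; exact hs.2) (hseg s ⟨hs.1.le, hs.2⟩) hsK
  exact absurd hs0 (ne_of_gt hs.1)

end Summit.FinalStateConjecture.FinalStateConjecture.Theorems.LaminatedThreshold.Negative

end
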